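import Summits.BirchSwinnertonDyer.BirchSwinnertonDyer.Theorems.UniversalToricDescentThinCombLevelRing
import Literature.NumberTheory.EllipticCurves.IwasawaAlgebraCharIdealProofs
import HarnessLib

/-!
# Thin-comb rigidity (crux idea `thin-comb-reflection` on `AdditiveSplitIMCInclusionAtThree`, item
# stmt-BirchSwinnertonDyer-20395) — Part II: descent in `R⟦T⟧` and VISIBILITY of primes of `Λ₂(𝒪) = 𝒪⟦T₂⟧⟦T₁⟧`
# on the comb (helper, `--supports stmt-BirchSwinnertonDyer-20395`; cell `pub/bsd-wall`, lead `cruxlead-20395`)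

* §4 DESCENT: for a prime non-zero-divisor `ϖ ∈ R`, a divisor of `ϖ^v·(unit constant)` in `R⟦T⟧` is `ϖ^s·(unit)`.
* §6 VISIBILITY: reduction `Λ₂(𝒪) → 𝒪_m⟦T₁⟧` (inner coefficients modulo `E_m`). INVISIBLE at level `m` means
  `p^N ∈ (Q, E_m(T₂))`, which forces the reduction of `Q` to have the shape `ϖ^s·(unit)` (descent). A non-unit
  `Q ∉ (p, T₂)` never has that shape (reduce further modulo `ϖ`: `𝒪_m/ϖ = 𝒪/p`); a `Q ∈ (p, T₁)` with `p ∤ Q`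
  does not have it on any level `m ≥ m₀(Q)` (its constant term lies in `p𝒪_m = (ϖ^d)`, forcing `s ≥ d`, while some
  `T₁`-coefficient has `ϖ`-order `< d`); and for `g ≠ 0` in `𝒪⟦X⟧`, `g ∈ (p^n)` in `𝒪_m` for `m ≥ m₀(g)` forces
  `(C p)^n ∣ g`.

`𝒪` is a discrete valuation ring with maximal ideal `(p)` (e.g. `ℤ_p`, `R₀ = W(𝔽̄_p)`). Nothing about elliptic
curves; BSD is not proved by any of this. Reference: Washington, Lemma 1.4, §7.1–7.2 [cite: Washington1997, §7.1–§7.2].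
-/

set_option linter.dupNamespace false

noncomputable section

namespace Summit.BirchSwinnertonDyer.BirchSwinnertonDyer.Theorems.UniversalToricDescentThinComb

open Polynomial

/-! ## §4 Descent in `R⟦T⟧`: divisors of `ϖ^v · (unit constant)` -/

section Descent

variable {R : Type*} [CommRing R]

/-- `C ϖ` is a non-zero-divisor of `R⟦T⟧` if `ϖ` is one of `R`. [cite: Washington1997, §7.1] -/
theorem C_mul_eq_zero_imp {ϖ : R} (hreg : ∀ z : R, ϖ * z = 0 → z = 0) {f : PowerSeries R}
    (hf : PowerSeries.C ϖ * f = 0) : f = 0 := by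
  ext n
  have := congrArg (PowerSeries.coeff n) hf
  rw [PowerSeries.coeff_C_mul, map_zero] at this
  simpa using hreg _ this

/-- **Descent lemma.** Let `ϖ ∈ R` be a prime non-zero-divisor. If `P · q = ϖ^v · c` in `R⟦T⟧` with `c` a unit
constant, then `P = ϖ^s · u` for some `s` and some unit `u` of `R⟦T⟧` (induction on `v`, reducing modulo the prime
`C ϖ` of `R⟦T⟧`). [cite: Washington1997, §7.1] -/
theorem exists_eq_C_pow_mul_unit_of_mul_eq {ϖ : R} (hϖ : Prime ϖ) (hreg : ∀ z : R, ϖ * z = 0 → z = 0) :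
    ∀ (v : ℕ) (P q : PowerSeries R) (c : R), IsUnit c →
      P * q = PowerSeries.C (ϖ ^ v * c) → ∃ (s : ℕ) (u : PowerSeries R), IsUnit u ∧ P = PowerSeries.C (ϖ ^ s) * u := by
  have hC : Prime (PowerSeries.C ϖ : PowerSeries R) := Literature.NumberTheory.EllipticCurves.prime_C_of_prime hϖ
  intro v
  induction v with
  | zero =>
    intro P q c hc h
    rw [pow_zero, one_mul] at h
    have hPu : IsUnit P := by
      refine isUnit_of_mul_isUnit_left (y := q) ?_
      rw [h, PowerSeries.isUnit_iff_constantCoeff]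
      simpa using hc
    exact ⟨0, P, hPu, by simp⟩
  | succ v ih =>
    intro P q c hc h
    have hdvd : (PowerSeries.C ϖ : PowerSeries R) ∣ P * q :=
      ⟨PowerSeries.C (ϖ ^ v * c), by rw [h, ← map_mul]; ring_nf⟩
    have e : PowerSeries.C ϖ * PowerSeries.C (ϖ ^ v * c) = PowerSeries.C (ϖ ^ (v + 1) * c) := by
      rw [← map_mul]; congr 1; ring
    rcases hC.dvd_or_dvd hdvd with ⟨P', rfl⟩ | ⟨q', rfl⟩
    · have h' : P' * q = PowerSeries.C (ϖ ^ v * c) := by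
        have h2 : PowerSeries.C ϖ * (P' * q - PowerSeries.C (ϖ ^ v * c)) = 0 := by
          rw [mul_sub, e, ← h]; ring
        exact sub_eq_zero.mp (C_mul_eq_zero_imp hreg h2)
      obtain ⟨s, u, hu, rfl⟩ := ih P' q c hc h'
      exact ⟨s + 1, u, hu, by rw [pow_succ, map_mul]; ring⟩
    · have h' : P * q' = PowerSeries.C (ϖ ^ v * c) := by
        have h2 : PowerSeries.C ϖ * (P * q' - PowerSeries.C (ϖ ^ v * c)) = 0 := by
          rw [mul_sub, e, ← h]; ring
        exact sub_eq_zero.mp (C_mul_eq_zero_imp hreg h2)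
      exact ih P q' c hc h'

end Descent

/-! ## §6 Visibility on the comb: reduction `Λ₂(𝒪) → 𝒪_m⟦T₁⟧` -/

section Visibility

variable (𝒪 : Type*) [CommRing 𝒪] [IsDomain 𝒪] [IsDiscreteValuationRing 𝒪] (p : ℕ) [hp : Fact p.Prime]

omit hp in
/-- Standing facts for a DVR `𝒪` with maximal ideal `(p)`: `p ≠ 0`, `p` is not a unit, `(p)` is prime, `p` is prime.
[cite: Washington1997, §7.1] -/
theorem p_ne_zero_of_maximalIdeal_eq (hmax : IsLocalRing.maximalIdeal 𝒪 = Ideal.span {(p : 𝒪)}) :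
    (p : 𝒪) ≠ 0 ∧ ¬ IsUnit (p : 𝒪) ∧ (Ideal.span {(p : 𝒪)}).IsPrime ∧ Prime (p : 𝒪) := by
  have hirr : Irreducible (p : 𝒪) := (IsDiscreteValuationRing.irreducible_iff_uniformizer _).mpr hmax
  refine ⟨hirr.ne_zero, hirr.not_isUnit, ?_, hirr.prime⟩
  rw [← hmax]; exact (IsLocalRing.maximalIdeal.isMaximal 𝒪).isPrime

variable (m : ℕ)

omit [IsDiscreteValuationRing 𝒪] in
/-- Cancellation of powers of `ϖ` in `𝒪_m`. [cite: Washington1997, §7.1] -/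
theorem varpi_pow_mul_eq_zero_imp (hp0 : (p : 𝒪) ≠ 0) (n : ℕ) {z : LevelRing 𝒪 p m}
    (hz : (Ideal.Quotient.mk (Ideal.span {combSeries 𝒪 p m}) PowerSeries.X) ^ n * z = 0) : z = 0 := by
  induction n generalizing z with
  | zero => simpa using hz
  | succ n ih =>
    rw [pow_succ, mul_assoc] at hz
    exact varpi_mul_eq_zero_imp 𝒪 p m hp0 (ih hz)

omit [IsDiscreteValuationRing 𝒪] in
/-- Cancellation of powers of `p` in `𝒪_m`. [cite: Washington1997, §7.1] -/
theorem natCast_p_pow_mul_eq_zero_imp (hp0 : (p : 𝒪) ≠ 0) (n : ℕ) {z : LevelRing 𝒪 p m}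
    (hz : (p : LevelRing 𝒪 p m) ^ n * z = 0) : z = 0 := by
  induction n generalizing z with
  | zero => simpa using hz
  | succ n ih =>
    rw [pow_succ, mul_assoc] at hz
    exact natCast_p_mul_eq_zero_imp 𝒪 p m hp0 (ih hz)

omit [IsDomain 𝒪] [IsDiscreteValuationRing 𝒪] in
/-- `ϖ` is not a unit of `𝒪_m` (`p` a non-unit of `𝒪`). [cite: Washington1997, §7.1] -/
theorem varpi_not_isUnit (hpu : ¬ IsUnit (p : 𝒪)) :
    ¬ IsUnit (Ideal.Quotient.mk (Ideal.span {combSeries 𝒪 p m}) PowerSeries.X) := by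
  intro hu
  have := varpi_pow_not_mem_span_succ 𝒪 p m hpu (l := 0) (natDegree_combPoly_pos p m)
  rw [pow_zero, zero_add, pow_one] at this
  exact this (Ideal.span_singleton_eq_top.mpr hu ▸ Submodule.mem_top)

omit [IsDomain 𝒪] [IsDiscreteValuationRing 𝒪] in
/-- **Core valuation lemma.** If `g ∈ 𝒪⟦X⟧` has `p ∣ [X^j]g` for `j < l` and `[X^l]g` a unit, then for every level
with `l < d = deg E_m` the class of `g` in `𝒪_m` is NOT in `(ϖ^{l+1})` (write `g = p·q + X^l·r` with `r` a unit
and use `p ∈ (ϖ^d) ⊆ (ϖ^{l+1})`, `ϖ^l ∉ (ϖ^{l+1})`). [cite: Washington1997, §7.1–§7.2] -/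
theorem mk_not_mem_span_varpi_pow_succ (hpu : ¬ IsUnit (p : 𝒪)) {g : PowerSeries 𝒪} {l : ℕ}
    (hlow : ∀ j, j < l → (p : 𝒪) ∣ PowerSeries.coeff j g) (hunit : IsUnit (PowerSeries.coeff l g))
    (hl : l < (combPoly p m).natDegree) :
    Ideal.Quotient.mk (Ideal.span {combSeries 𝒪 p m}) g ∉
      Ideal.span {(Ideal.Quotient.mk (Ideal.span {combSeries 𝒪 p m}) PowerSeries.X) ^ (l + 1)} := by
  classical
  set π := Ideal.Quotient.mk (Ideal.span {combSeries 𝒪 p m}) with hπ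
  -- `g = C p * q + X^l * r`
  choose c hc using hlow
  let q : PowerSeries 𝒪 := PowerSeries.mk fun j => if h : j < l then c j h else 0
  have hdvd : (PowerSeries.X : PowerSeries 𝒪) ^ l ∣ g - PowerSeries.C (p : 𝒪) * q := by
    rw [PowerSeries.X_pow_dvd_iff]
    intro j hj
    rw [map_sub, PowerSeries.coeff_C_mul, PowerSeries.coeff_mk, dif_pos hj, ← hc j hj, sub_self]
  obtain ⟨r, hr⟩ := hdvd
  have hr1 : IsUnit r := by
    rw [PowerSeries.isUnit_iff_constantCoeff]
    have := congrArg (PowerSeries.coeff l) hr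
    rw [PowerSeries.coeff_X_pow_mul', if_pos le_rfl, Nat.sub_self, map_sub, PowerSeries.coeff_C_mul,
      PowerSeries.coeff_mk, dif_neg (lt_irrefl l), mul_zero, sub_zero,
      PowerSeries.coeff_zero_eq_constantCoeff_apply] at this
    rw [← this]; exact hunit
  have hg : g = PowerSeries.C (p : 𝒪) * q + PowerSeries.X ^ l * r := by rw [← hr]; ring
  intro hmem
  have hpmem : π (PowerSeries.C (p : 𝒪)) ∈ Ideal.span {π PowerSeries.X ^ (l + 1)} := by
    have h1 : π (PowerSeries.C (p : 𝒪)) = (p : LevelRing 𝒪 p m) := by simp [hπ]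
    rw [h1]
    exact (Ideal.span_singleton_le_span_singleton.mpr (pow_dvd_pow _ (Nat.succ_le_of_lt hl)))
      (natCast_p_mem_span_varpi_pow 𝒪 p m)
  have hXr : π PowerSeries.X ^ l * π r ∈ Ideal.span {π PowerSeries.X ^ (l + 1)} := by
    have : π g = π (PowerSeries.C (p : 𝒪)) * π q + π PowerSeries.X ^ l * π r := by
      rw [hg, map_add, map_mul, map_mul, map_pow]
    have h2 : π PowerSeries.X ^ l * π r = π g - π (PowerSeries.C (p : 𝒪)) * π q := by rw [this]; ring
    rw [h2]
    exact Ideal.sub_mem _ hmem (Ideal.mul_mem_right _ _ hpmem)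
  obtain ⟨ru, hru⟩ := hr1.map π
  apply varpi_pow_not_mem_span_succ 𝒪 p m hpu hl
  have : π PowerSeries.X ^ l = π PowerSeries.X ^ l * π r * ↑ru⁻¹ := by
    rw [← hru, Units.mul_inv_cancel_right]
  rw [this]
  exact Ideal.mul_mem_right _ _ hXr

omit hp in
/-- The first coefficient of `g ∈ 𝒪⟦X⟧` not divisible by `p` is a unit when `𝒪` is local with maximal ideal `(p)`
and `C p ∤ g`. [cite: Washington1997, §7.1] -/
theorem exists_first_unit_coeff (hmax : IsLocalRing.maximalIdeal 𝒪 = Ideal.span {(p : 𝒪)}) {g : PowerSeries 𝒪}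
    (hg : ¬ PowerSeries.C (p : 𝒪) ∣ g) :
    ∃ l : ℕ, (∀ j, j < l → (p : 𝒪) ∣ PowerSeries.coeff j g) ∧ IsUnit (PowerSeries.coeff l g) := by
  classical
  have hex : ∃ j, ¬ (p : 𝒪) ∣ PowerSeries.coeff j g := by
    by_contra hall
    push Not at hall
    apply hg
    choose c hc using hall
    exact ⟨PowerSeries.mk c, by ext j; rw [PowerSeries.coeff_C_mul, PowerSeries.coeff_mk, hc]⟩
  refine ⟨Nat.find hex, fun j hj => ?_, ?_⟩
  · have := Nat.find_min hex hj
    push Not at this; exact this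
  · have h := Nat.find_spec hex
    rw [← Ideal.mem_span_singleton, ← hmax] at h
    exact IsLocalRing.notMem_maximalIdeal.mp h

omit [IsDomain 𝒪] [IsDiscreteValuationRing 𝒪] hp in
/-- If the reduction `Λ₂(𝒪) → (𝒪/p)⟦T₁⟧`, `T₂ ↦ 0`, kills `Q`, then `Q ∈ (p, T₂)`. [cite: Washington1997, §7.1] -/
theorem mem_span_const_T₂_of_map_eq_zero {Q : PowerSeries (PowerSeries 𝒪)}
    (h : PowerSeries.map ((Ideal.Quotient.mk (Ideal.span {(p : 𝒪)})).comp PowerSeries.constantCoeff) Q = 0) :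
    Q ∈ Ideal.span {const 𝒪 (p : 𝒪), T₂ 𝒪} := by
  classical
  have hi : ∀ i, (p : 𝒪) ∣ PowerSeries.constantCoeff (PowerSeries.coeff i Q) := by
    intro i
    have := congrArg (PowerSeries.coeff i) h
    rw [PowerSeries.coeff_map, map_zero, RingHom.comp_apply, Ideal.Quotient.eq_zero_iff_mem,
      Ideal.mem_span_singleton] at this
    exact this
  choose b hb using hi
  rw [Ideal.mem_span_pair]
  refine ⟨PowerSeries.mk fun i => PowerSeries.C (b i),
    PowerSeries.mk fun i => PowerSeries.mk fun j => PowerSeries.coeff (j + 1) (PowerSeries.coeff i Q), ?_⟩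
  rw [mul_comm (PowerSeries.mk fun i => PowerSeries.C (b i)), mul_comm (PowerSeries.mk fun i =>
    PowerSeries.mk fun j => PowerSeries.coeff (j + 1) (PowerSeries.coeff i Q))]
  ext i : 1
  rw [map_add, show const 𝒪 (p : 𝒪) = PowerSeries.C (PowerSeries.C (p : 𝒪)) from rfl, T₂,
    PowerSeries.coeff_C_mul, PowerSeries.coeff_C_mul, PowerSeries.coeff_mk, PowerSeries.coeff_mk]
  conv_rhs => rw [PowerSeries.eq_X_mul_shift_add_const (PowerSeries.coeff i Q), hb i, map_mul]
  ring

/-- **Strongly visible primes never look invisible**: if `Q ∉ (p, T₂)` and `Q` is not a unit, the reduction of `Q` to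
`𝒪_m⟦T₁⟧` is never of the shape `ϖ^s · (unit)`, at ANY level `m`. [cite: Washington1997, §7.1–§7.2] -/
theorem not_shape_of_not_mem_span_T₂ (hmax : IsLocalRing.maximalIdeal 𝒪 = Ideal.span {(p : 𝒪)})
    {Q : PowerSeries (PowerSeries 𝒪)} (hQ : Q ∉ Ideal.span {const 𝒪 (p : 𝒪), T₂ 𝒪}) (hQu : ¬ IsUnit Q) :
    ¬ ∃ (s : ℕ) (u : PowerSeries (LevelRing 𝒪 p m)), IsUnit u ∧
      PowerSeries.map (Ideal.Quotient.mk (Ideal.span {combSeries 𝒪 p m})) Q =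
        PowerSeries.C ((Ideal.Quotient.mk (Ideal.span {combSeries 𝒪 p m}) PowerSeries.X) ^ s) * u := by
  obtain ⟨-, hpu, hprime, -⟩ := p_ne_zero_of_maximalIdeal_eq 𝒪 p hmax
  haveI := hprime
  haveI : Nontrivial (𝒪 ⧸ Ideal.span {(p : 𝒪)}) := Ideal.Quotient.nontrivial_iff.mpr hprime.ne_top
  obtain ⟨σ, -, hσ, hker⟩ := exists_levelRing_to_residue 𝒪 p m
  rintro ⟨s, u, hu, hshape⟩
  have hσϖ : σ (Ideal.Quotient.mk (Ideal.span {combSeries 𝒪 p m}) PowerSeries.X) = 0 := by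
    rw [← RingHom.mem_ker, hker]; exact Ideal.mem_span_singleton_self _
  have hθ : PowerSeries.map ((Ideal.Quotient.mk (Ideal.span {(p : 𝒪)})).comp PowerSeries.constantCoeff) Q =
      PowerSeries.C (σ (Ideal.Quotient.mk (Ideal.span {combSeries 𝒪 p m}) PowerSeries.X) ^ s) *
        PowerSeries.map σ u := by
    rw [← hσ, PowerSeries.map_comp, RingHom.comp_apply, hshape, map_mul, PowerSeries.map_C, map_pow]
  rcases Nat.eq_zero_or_pos s with rfl | hs
  · -- `s = 0`: the reduction of `Q` mod `(p, T₂)` is a unit, but `Q(0,0) ∈ (p)`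
    rw [pow_zero, map_one, one_mul] at hθ
    have hunit : IsUnit (PowerSeries.map ((Ideal.Quotient.mk (Ideal.span {(p : 𝒪)})).comp
        PowerSeries.constantCoeff) Q) := hθ ▸ hu.map _
    have h1 := PowerSeries.isUnit_constantCoeff _ hunit
    rw [← PowerSeries.coeff_zero_eq_constantCoeff_apply, PowerSeries.coeff_map, RingHom.comp_apply,
      PowerSeries.coeff_zero_eq_constantCoeff_apply] at h1
    have hQ0 : PowerSeries.constantCoeff (PowerSeries.constantCoeff Q) ∈ Ideal.span {(p : 𝒪)} := by
      rw [← hmax, IsLocalRing.mem_maximalIdeal, mem_nonunits_iff]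
      intro hu0
      exact hQu (PowerSeries.isUnit_iff_constantCoeff.mpr (PowerSeries.isUnit_iff_constantCoeff.mpr hu0))
    rw [Ideal.Quotient.eq_zero_iff_mem.mpr hQ0] at h1
    exact not_isUnit_zero h1
  · -- `s ≥ 1`: the reduction of `Q` mod `(p, T₂)` vanishes, so `Q ∈ (p, T₂)`
    rw [hσϖ, zero_pow hs.ne', map_zero, zero_mul] at hθ
    exact hQ (mem_span_const_T₂_of_map_eq_zero 𝒪 p hθ)

/-- **Invisible on a level ⇒ shape `ϖ^s·unit`.** If `p^N ∈ (Q, E_m(T₂))` in `Λ₂(𝒪)` then the reduction of `Q`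
to `𝒪_m⟦T₁⟧` divides the constant `p^N = ϖ^{dN}·unit`, hence is `ϖ^s · (unit)` by the descent lemma.
[cite: Washington1997, §7.1–§7.2] -/
theorem shape_of_const_pow_mem (hmax : IsLocalRing.maximalIdeal 𝒪 = Ideal.span {(p : 𝒪)})
    {Q : PowerSeries (PowerSeries 𝒪)} {N : ℕ}
    (h : const 𝒪 ((p : 𝒪) ^ N) ∈ Ideal.span {Q, combElt 𝒪 p m}) :
    ∃ (s : ℕ) (u : PowerSeries (LevelRing 𝒪 p m)), IsUnit u ∧
      PowerSeries.map (Ideal.Quotient.mk (Ideal.span {combSeries 𝒪 p m})) Q =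
        PowerSeries.C ((Ideal.Quotient.mk (Ideal.span {combSeries 𝒪 p m}) PowerSeries.X) ^ s) * u := by
  obtain ⟨hp0, -, hprime, -⟩ := p_ne_zero_of_maximalIdeal_eq 𝒪 p hmax
  haveI := hprime
  set π := Ideal.Quotient.mk (Ideal.span {combSeries 𝒪 p m}) with hπ
  obtain ⟨a, b, hab⟩ := Ideal.mem_span_pair.mp h
  have hred : PowerSeries.map π a * PowerSeries.map π Q = PowerSeries.C ((p : LevelRing 𝒪 p m) ^ N) := by
    have := congrArg (PowerSeries.map π) hab
    rw [map_add, map_mul, map_mul] at this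
    have hE : PowerSeries.map π (combElt 𝒪 p m) = 0 := by
      rw [combElt, PowerSeries.map_C, Ideal.Quotient.eq_zero_iff_mem.mpr (Ideal.mem_span_singleton_self _),
        map_zero]
    rw [hE, mul_zero, add_zero] at this
    rw [this, const, RingHom.comp_apply, PowerSeries.map_C]
    simp [hπ]
  obtain ⟨w, hw⟩ := exists_natCast_p_eq_varpi_pow_mul 𝒪 p m
  rw [hw, mul_pow, ← pow_mul, ← Units.val_pow_eq_pow_val, mul_comm (PowerSeries.map π a)] at hred
  exact exists_eq_C_pow_mul_unit_of_mul_eq (varpi_prime 𝒪 p m hp0)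
    (fun z hz => varpi_mul_eq_zero_imp 𝒪 p m hp0 hz) _ _ _ _ (Units.isUnit _) hred

/-- **Primes in `(p, T₁)` not divisible by `p` are visible on all deep levels**: if `Q ∈ (p, T₁)` and `p ∤ Q`, then
for all levels `m ≥ m₀` the reduction of `Q` to `𝒪_m⟦T₁⟧` is not of the shape `ϖ^s·(unit)` (the constant term of
`Q` lies in `p·𝒪_m = (ϖ^d)`, forcing `s ≥ d`, while some `T₁`-coefficient of `Q` has `ϖ`-order `< d`).
[cite: Washington1997, §7.1–§7.2] -/
theorem exists_level_not_shape_of_mem_span_T₁ (hmax : IsLocalRing.maximalIdeal 𝒪 = Ideal.span {(p : 𝒪)})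
    {Q : PowerSeries (PowerSeries 𝒪)} (hQ1 : Q ∈ Ideal.span {const 𝒪 (p : 𝒪), T₁ 𝒪})
    (hQp : ¬ const 𝒪 (p : 𝒪) ∣ Q) :
    ∃ m₀ : ℕ, ∀ m : ℕ, m₀ ≤ m → ¬ ∃ (s : ℕ) (u : PowerSeries (LevelRing 𝒪 p m)), IsUnit u ∧
      PowerSeries.map (Ideal.Quotient.mk (Ideal.span {combSeries 𝒪 p m})) Q =
        PowerSeries.C ((Ideal.Quotient.mk (Ideal.span {combSeries 𝒪 p m}) PowerSeries.X) ^ s) * u := by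
  classical
  obtain ⟨hp0, hpu, -, -⟩ := p_ne_zero_of_maximalIdeal_eq 𝒪 p hmax
  -- some `T₁`-coefficient of `Q` is not divisible by `p`
  have hex : ∃ i, ¬ PowerSeries.C (p : 𝒪) ∣ PowerSeries.coeff i Q := by
    by_contra hall
    push Not at hall
    apply hQp
    choose c hc using hall
    refine ⟨PowerSeries.mk c, ?_⟩
    ext i j
    rw [const, RingHom.comp_apply, PowerSeries.coeff_C_mul, PowerSeries.coeff_mk, hc]
  obtain ⟨i, hi⟩ := hex
  obtain ⟨l, hlow, hunit⟩ := exists_first_unit_coeff 𝒪 p hmax hi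
  refine ⟨l, fun m hm => ?_⟩
  have hl : l < (combPoly p m).natDegree := lt_of_le_of_lt hm (lt_natDegree_combPoly p m)
  set π := Ideal.Quotient.mk (Ideal.span {combSeries 𝒪 p m}) with hπ
  set d := (combPoly p m).natDegree with hd
  rintro ⟨s, u, hu, hshape⟩
  -- (ii) the constant term of `Q` reduces into `(ϖ^d)`
  have hc0 : π (PowerSeries.constantCoeff Q) ∈ Ideal.span {π PowerSeries.X ^ d} := by
    obtain ⟨a, b, hab⟩ := Ideal.mem_span_pair.mp hQ1
    have : PowerSeries.constantCoeff Q = PowerSeries.constantCoeff a * PowerSeries.C (p : 𝒪) := by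
      rw [← hab, map_add, map_mul, map_mul, const, T₁, RingHom.comp_apply, PowerSeries.constantCoeff_C,
        PowerSeries.constantCoeff_X, mul_zero, add_zero]
    rw [this, map_mul]
    have h1 : π (PowerSeries.C (p : 𝒪)) = (p : LevelRing 𝒪 p m) := by simp [hπ]
    rw [h1]
    exact Ideal.mul_mem_left _ _ (natCast_p_mem_span_varpi_pow 𝒪 p m)
  have hc0' : π (PowerSeries.constantCoeff Q) = π PowerSeries.X ^ s * PowerSeries.constantCoeff u := by
    have := congrArg (PowerSeries.coeff 0) hshape
    rwa [PowerSeries.coeff_map, PowerSeries.coeff_C_mul, PowerSeries.coeff_zero_eq_constantCoeff_apply,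
      PowerSeries.coeff_zero_eq_constantCoeff_apply] at this
  have hu0 : IsUnit (PowerSeries.constantCoeff u) := PowerSeries.isUnit_constantCoeff u hu
  -- (iii) `s ≥ d`
  have hsd : d ≤ s := by
    by_contra hlt
    push Not at hlt
    rw [hc0'] at hc0
    obtain ⟨y, hy⟩ := Ideal.mem_span_singleton'.mp hc0
    -- `ϖ^s · (u₀ - ϖ^{d-s} y) = 0`
    have : π PowerSeries.X ^ s * (PowerSeries.constantCoeff u - π PowerSeries.X ^ (d - s) * y) = 0 := by
      rw [mul_sub, ← hy, ← mul_assoc, ← pow_add, Nat.add_sub_cancel' hlt.le]; ring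
    have h2 := varpi_pow_mul_eq_zero_imp 𝒪 p m hp0 s this
    rw [sub_eq_zero] at h2
    apply varpi_not_isUnit 𝒪 p m hpu
    have : IsUnit (π PowerSeries.X ^ (d - s) * y) := h2 ▸ hu0
    exact isUnit_of_dvd_unit (dvd_mul_of_dvd_left (dvd_pow_self _ (Nat.sub_ne_zero_of_lt hlt)) y) this
  -- (iv) the `i`-th coefficient reduces into `(ϖ^s) ⊆ (ϖ^{l+1})` — contradiction with the core lemma
  apply mk_not_mem_span_varpi_pow_succ 𝒪 p m hpu hlow hunit hl
  have hci : π (PowerSeries.coeff i Q) = π PowerSeries.X ^ s * PowerSeries.coeff i u := by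
    have := congrArg (PowerSeries.coeff i) hshape
    rwa [PowerSeries.coeff_map, PowerSeries.coeff_C_mul] at this
  rw [hci]
  refine Ideal.mul_mem_right _ _ ?_
  exact Ideal.span_singleton_le_span_singleton.mpr (pow_dvd_pow _ (le_trans (Nat.succ_le_of_lt hl) hsd))
    (Ideal.mem_span_singleton_self _)

/-- **Detecting `p`-powers on deep levels**: for `g ≠ 0` in `𝒪⟦X⟧` and every level `m ≥ m₀(g)`, if the class of
`g` in `𝒪_m` lies in `(p^n)` then `(C p)^n ∣ g`. [cite: Washington1997, §7.1–§7.2] -/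
theorem C_pow_dvd_of_mk_mem_span (hmax : IsLocalRing.maximalIdeal 𝒪 = Ideal.span {(p : 𝒪)})
    {g : PowerSeries 𝒪} (hg : g ≠ 0) :
    ∃ m₀ : ℕ, ∀ m : ℕ, m₀ ≤ m → ∀ n : ℕ,
      Ideal.Quotient.mk (Ideal.span {combSeries 𝒪 p m}) g ∈ Ideal.span {(p : LevelRing 𝒪 p m) ^ n} →
        PowerSeries.C (p : 𝒪) ^ n ∣ g := by
  obtain ⟨hp0, hpu, -, hpprime⟩ := p_ne_zero_of_maximalIdeal_eq 𝒪 p hmax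
  have hCp : ¬ IsUnit (PowerSeries.C (p : 𝒪)) := fun h => hpu (by simpa using PowerSeries.isUnit_constantCoeff _ h)
  obtain ⟨μ, g₀, hndvd, rfl⟩ := WfDvdMonoid.max_power_factor' hg hCp
  obtain ⟨l, hlow, hunit⟩ := exists_first_unit_coeff 𝒪 p hmax hndvd
  refine ⟨l, fun m hm n hmem => ?_⟩
  have hl : l < (combPoly p m).natDegree := lt_of_le_of_lt hm (lt_natDegree_combPoly p m)
  set π := Ideal.Quotient.mk (Ideal.span {combSeries 𝒪 p m}) with hπ
  rcases le_or_gt n μ with hle | hlt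
  · exact dvd_mul_of_dvd_left (pow_dvd_pow _ hle) _
  · exfalso
    obtain ⟨y, hy⟩ := Ideal.mem_span_singleton'.mp hmem
    have h1 : π (PowerSeries.C (p : 𝒪)) = (p : LevelRing 𝒪 p m) := by simp [hπ]
    rw [map_mul, map_pow, h1] at hy
    -- cancel `p^μ`
    have : (p : LevelRing 𝒪 p m) ^ μ * (π g₀ - (p : LevelRing 𝒪 p m) ^ (n - μ) * y) = 0 := by
      rw [mul_sub, ← hy, ← mul_assoc, ← pow_add, Nat.add_sub_cancel' hlt.le]; ring
    have h2 := natCast_p_pow_mul_eq_zero_imp 𝒪 p m hp0 μ this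
    rw [sub_eq_zero] at h2
    apply mk_not_mem_span_varpi_pow_succ 𝒪 p m hpu hlow hunit hl
    rw [h2]
    refine Ideal.mul_mem_right _ _ ?_
    have hpd := natCast_p_mem_span_varpi_pow 𝒪 p m
    have : Ideal.span {π PowerSeries.X ^ (combPoly p m).natDegree} ≤ Ideal.span {π PowerSeries.X ^ (l + 1)} :=
      Ideal.span_singleton_le_span_singleton.mpr (pow_dvd_pow _ (Nat.succ_le_of_lt hl))
    exact Ideal.pow_mem_of_mem _ (this hpd) _ (Nat.sub_pos_of_lt hlt)

end Visibility

end Summit.BirchSwinnertonDyer.BirchSwinnertonDyer.Theorems.UniversalToricDescentThinComb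

end
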